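import Literature.AlgebraicGeometry.Resolution.TameCyclicFixedRing
import Literature.AlgebraicGeometry.Resolution.AffineDomainDimension
import Literature.AlgebraicGeometry.Resolution.LocalBlowup
import HarnessLib

/-!
# Krull dimension of rings of invariants of tame automorphisms (cyclic and commuting families)

Topic: `Literature/AlgebraicGeometry/Resolution`. PROOF side of `CossartPiltant2019ReductionP`
(`ArithmeticalThreefoldsLocal.lean`), input (C4), toric route. The dimension hypothesis of the
toric descent steps (`TameCyclicToricDescent.lean`, `TameAbelianToricDescent.lean`) is
discharged by the dimension formula over the ring of invariants `A`, which needs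
`dim A = dim B`: `B` is finite over the invariants of one tame cyclic automorphism
(`TameCyclicFixedRing.module_finite_fixedSubring_of_tameCyclic`, [CoP1] proof of Lemma 9.4:
"`S₁` lies above `R₁ := S₁^G`"), hence integral, so the dimensions agree (Matsumura Thm. 9.4,
`ringKrullDim_eq_of_isIntegral`); iterating along a commuting family gives the same for joint
invariants.

* `ringKrullDim_fixedSubring_eq` — PROVED (one tame cyclic automorphism of a subring of a field).
* `ringKrullDim_fixedSubring_of_commuting_eq` — PROVED (a commuting family).

Everything is PROVED; no named facts are introduced.

## Sources

* V. Cossart, O. Piltant, *Resolution of singularities of threefolds in positive characteristic.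
  I*, J. Algebra 320 (2008) 1051–1082: proof of Lemma 9.4 (HAL hal-00139124, p. 29).
  [CossartPiltant2008]
* H. Matsumura, *Commutative Ring Theory* (1986), Thm. 9.4. [Matsumura1987]
-/

noncomputable section

namespace Literature.AlgebraicGeometry.Resolution

universe u

open IsLocalRing

section Dimension

variable {F : Type u} [Field F]

/-- **`dim B^τ = dim B` for a tame cyclic automorphism** ([CoP1] proof of Lemma 9.4: "`S₁`
lies above `R₁ := S₁^G`" — `B` is finite over its invariants; Matsumura Thm. 9.4). Let `τ` be an
automorphism of the field `F` with `τ^ℓ = 1` preserving a Noetherian subring `B` with `ℓ ∈ B^×`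
and a fixed `ℓ`-th root of unity `ζ ∈ B` (`ζ^k - 1 ∈ B^×`, `0 < k < ℓ`), and
`B' = {b ∈ B : τ b = b}`. Then `dim B' = dim B`.
[cite: CossartPiltant2008, proof of Lemma 9.4 (HAL p. 29), "S₁ lies above R₁"]
[cite: Matsumura1987, Thm. 9.4] -/
theorem ringKrullDim_fixedSubring_eq (τ : F ≃+* F) {ℓ : ℕ} (hℓ0 : ℓ ≠ 0) (hτℓ : τ ^ ℓ = 1)
    (B : Subring F) [IsNoetherianRing B] (hτB : ∀ b ∈ B, τ b ∈ B) (hℓu : IsUnit ((ℓ : B)))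
    (ζ : F) (hζB : ζ ∈ B) (hτζ : τ ζ = ζ) (hζℓ : ζ ^ ℓ = 1)
    (hζu : ∀ k : ℕ, 0 < k → k < ℓ → IsUnit ((⟨ζ, hζB⟩ : B) ^ k - 1))
    (B' : Subring F) (hB' : ∀ b, b ∈ B' ↔ b ∈ B ∧ τ b = b) :
    ringKrullDim B' = ringKrullDim B := by
  classical
  have hℓpos : 0 < ℓ := Nat.pos_of_ne_zero hℓ0
  have hτsymm : ∀ b : F, τ.symm b = (τ ^ (ℓ - 1)) b := fun b => by
    rw [RingEquiv.symm_apply_eq]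
    change b = (τ * τ ^ (ℓ - 1)) b
    rw [← pow_succ', Nat.sub_add_cancel hℓpos, hτℓ]
    rfl
  have hτpowB : ∀ (k : ℕ) (b : F), b ∈ B → (τ ^ k) b ∈ B := by
    intro k
    induction k with
    | zero => intro b hb; exact hb
    | succ k ih => intro b hb; rw [pow_succ', RingAut.mul_apply]; exact hτB _ (ih b hb)
  have hτB' : ∀ b ∈ B, τ.symm b ∈ B := fun b hb => by rw [hτsymm]; exact hτpowB _ b hb
  let σ : B ≃+* B :=
    { toFun := fun b => ⟨τ b, hτB b b.2⟩
      invFun := fun b => ⟨τ.symm b, hτB' b b.2⟩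
      left_inv := fun b => Subtype.ext (τ.symm_apply_apply b)
      right_inv := fun b => Subtype.ext (τ.apply_symm_apply b)
      map_mul' := fun a b => Subtype.ext (map_mul τ (a : F) (b : F))
      map_add' := fun a b => Subtype.ext (map_add τ (a : F) (b : F)) }
  have hσ_apply : ∀ b : B, ((σ b : B) : F) = τ b := fun b => rfl
  have hσpow : ∀ (k : ℕ) (b : B), (((σ ^ k) b : B) : F) = (τ ^ k) (b : F) := by
    intro k
    induction k with
    | zero => intro b; rfl
    | succ k ih => intro b; rw [pow_succ', RingAut.mul_apply, pow_succ', RingAut.mul_apply, hσ_apply, ih]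
  have hσℓ : σ ^ ℓ = 1 := RingEquiv.ext fun b => Subtype.ext (by rw [hσpow, hτℓ]; rfl)
  let ζB : B := ⟨ζ, hζB⟩
  have hσζ : σ ζB = ζB := Subtype.ext hτζ
  have hζBℓ : ζB ^ ℓ = 1 := Subtype.ext (by
    change ((ζB ^ ℓ : B) : F) = 1
    rw [SubmonoidClass.coe_pow]; exact hζℓ)
  let AB : Subring B := B'.comap B.subtype
  have hAB : ∀ b : B, b ∈ AB ↔ σ b = b := fun b => by
    change (b : F) ∈ B' ↔ _
    rw [hB', Subtype.ext_iff, hσ_apply]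
    exact ⟨fun h => h.2, fun h => ⟨b.2, h⟩⟩
  haveI : Module.Finite AB B :=
    module_finite_fixedSubring_of_tameCyclic σ AB hAB hℓ0 hσℓ hℓu ζB hσζ hζBℓ hζu
  haveI : Algebra.IsIntegral AB B := Algebra.IsIntegral.of_finite AB B
  have h1 : ringKrullDim B = ringKrullDim AB :=
    ringKrullDim_eq_of_isIntegral (R := AB) (S := B) Subtype.val_injective
  have hB'le : B' ≤ B := fun a ha => ((hB' a).mp ha).1
  let e : AB ≃+* B' :=
    { toFun := fun a => ⟨((a : B) : F), a.2⟩
      invFun := fun a => ⟨⟨(a : F), hB'le a.2⟩, a.2⟩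
      left_inv := fun a => rfl
      right_inv := fun a => rfl
      map_mul' := fun a b => rfl
      map_add' := fun a b => rfl }
  rw [← ringKrullDim_eq_of_ringEquiv e, ← h1]

/-- **`dim A = dim B` for the joint invariants of a commuting family of tame automorphisms**
(iterate `ringKrullDim_fixedSubring_eq`; the intermediate invariant rings are Noetherian by
`TameCyclicFixedRing.isNoetherianRing_fixedSubring_of_tameCyclic`).
[cite: CossartPiltant2008, proof of Lemma 9.4 (HAL p. 29), "S₁ lies above R₁"]
[cite: Matsumura1987, Thm. 9.4] -/
theorem ringKrullDim_fixedSubring_of_commuting_eq (τ : ℕ → F ≃+* F) (r : ℕ) {ℓ : ℕ}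
    (hℓ0 : ℓ ≠ 0) (hτℓ : ∀ i < r, τ i ^ ℓ = 1)
    (hcomm : ∀ i < r, ∀ i' < r, ∀ z : F, τ i (τ i' z) = τ i' (τ i z))
    (B : Subring F) [IsNoetherianRing B] (hτB : ∀ i < r, ∀ b ∈ B, τ i b ∈ B)
    (hℓu : IsUnit ((ℓ : B))) (ζ : F) (hζB : ζ ∈ B) (hτζ : ∀ i < r, τ i ζ = ζ) (hζℓ : ζ ^ ℓ = 1)
    (hζu : ∀ k : ℕ, 0 < k → k < ℓ → IsUnit ((⟨ζ, hζB⟩ : B) ^ k - 1))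
    (A : Subring F) (hA : ∀ b, b ∈ A ↔ b ∈ B ∧ ∀ i < r, τ i b = b) :
    ringKrullDim A = ringKrullDim B := by
  classical
  have hℓpos : 0 < ℓ := Nat.pos_of_ne_zero hℓ0
  let Fix : ℕ → Subring F := fun i =>
    { carrier := {z | τ i z = z}
      mul_mem' := fun {a b} ha hb => by change τ i (a * b) = a * b; rw [map_mul, ha, hb]
      one_mem' := map_one (τ i)
      add_mem' := fun {a b} ha hb => by change τ i (a + b) = a + b; rw [map_add, ha, hb]
      zero_mem' := map_zero (τ i)
      neg_mem' := fun {a} ha => by change τ i (-a) = -a; rw [map_neg, ha] }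
  have hFix : ∀ i z, z ∈ Fix i ↔ τ i z = z := fun i z => Iff.rfl
  let Cf : ℕ → Subring F :=
    fun k => Nat.rec (motive := fun _ => Subring F) B (fun i acc => acc ⊓ Fix i) k
  have hCf0 : Cf 0 = B := rfl
  have hCfsucc : ∀ k, Cf (k + 1) = Cf k ⊓ Fix k := fun k => rfl
  have hmemCf : ∀ k b, b ∈ Cf k ↔ b ∈ B ∧ ∀ i < k, τ i b = b := by
    intro k
    induction k with
    | zero => intro b; simp [hCf0]
    | succ k ih =>
      intro b
      rw [hCfsucc, Subring.mem_inf, ih, hFix]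
      constructor
      · rintro ⟨⟨hbB, hb⟩, hbk⟩
        exact ⟨hbB, fun i hi => by
          rcases Nat.lt_succ_iff_lt_or_eq.mp hi with hi | rfl
          · exact hb i hi
          · exact hbk⟩
      · rintro ⟨hbB, hb⟩
        exact ⟨⟨hbB, fun i hi => hb i (Nat.lt_succ_of_lt hi)⟩, hb k (Nat.lt_succ_self k)⟩
  have hCfle : ∀ k, Cf k ≤ B := fun k b hb => ((hmemCf k b).mp hb).1
  -- induction: `C_k` Noetherian with `dim C_k = dim B`
  have key : ∀ k, k ≤ r → ∃ (_ : IsNoetherianRing (Cf k)), ringKrullDim (Cf k) = ringKrullDim B := by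
    intro k
    induction k with
    | zero => intro _; exact ⟨(inferInstance : IsNoetherianRing B), rfl⟩
    | succ k ih =>
      intro hk
      have hk' : k < r := Nat.lt_of_succ_le hk
      obtain ⟨hnoe, hdimk⟩ := ih hk'.le
      haveI := hnoe
      have hτCk : ∀ c ∈ Cf k, τ k c ∈ Cf k := by
        intro c hc
        rw [hmemCf] at hc ⊢
        refine ⟨hτB k hk' c hc.1, fun i hi => ?_⟩
        rw [hcomm i (hi.trans hk') k hk', hc.2 i hi]
      -- units of `B` in `C_k` are units of `C_k`
      have hunitk : ∀ (a : Cf k), IsUnit (⟨(a : F), hCfle k a.2⟩ : B) → IsUnit a := by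
        intro a h
        obtain ⟨v, hv⟩ := h.exists_right_inv
        have hv' : (a : F) * (v : F) = 1 := by
          have := congrArg Subtype.val hv
          simpa using this
        have ha := (hmemCf k (a : F)).mp a.2
        have hτv : ∀ i < k, τ i (v : F) = v := by
          intro i hi
          have h1 : (a : F) * τ i (v : F) = 1 := by
            have := congrArg (τ i) hv'
            rwa [map_mul, ha.2 i hi, map_one] at this
          calc τ i (v : F) = τ i (v : F) * ((a : F) * (v : F)) := by rw [hv', mul_one]
            _ = ((a : F) * τ i (v : F)) * (v : F) := by ring
            _ = v := by rw [h1, one_mul]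
        exact IsUnit.of_mul_eq_one (⟨(v : F), (hmemCf k _).mpr ⟨v.2, hτv⟩⟩ : Cf k) (Subtype.ext hv')
      have hℓuk : IsUnit ((ℓ : Cf k)) := hunitk _ (by
        have : (⟨((ℓ : Cf k) : F), hCfle k (ℓ : Cf k).2⟩ : B) = (ℓ : B) := Subtype.ext (by simp)
        rw [this]; exact hℓu)
      have hζCk : ζ ∈ Cf k := (hmemCf k ζ).mpr ⟨hζB, fun i hi => hτζ i (hi.trans hk')⟩
      have hζuk : ∀ j : ℕ, 0 < j → j < ℓ → IsUnit ((⟨ζ, hζCk⟩ : Cf k) ^ j - 1) := by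
        intro j hj hjℓ
        refine hunitk _ ?_
        have : (⟨(((⟨ζ, hζCk⟩ : Cf k) ^ j - 1 : Cf k) : F), hCfle k ((⟨ζ, hζCk⟩ : Cf k) ^ j - 1).2⟩ : B) =
            (⟨ζ, hζB⟩ : B) ^ j - 1 := Subtype.ext (by simp)
        rw [this]; exact hζu j hj hjℓ
      have hC' : ∀ b, b ∈ Cf (k + 1) ↔ b ∈ Cf k ∧ τ k b = b := fun b => by
        rw [hCfsucc, Subring.mem_inf, hFix]
      -- Noetherianity of `C_{k+1}` through the cyclic brick, transported
      have hτsymm : ∀ b : F, (τ k).symm b = (τ k ^ (ℓ - 1)) b := fun b => by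
        rw [RingEquiv.symm_apply_eq]
        change b = (τ k * τ k ^ (ℓ - 1)) b
        rw [← pow_succ', Nat.sub_add_cancel hℓpos, hτℓ k hk']
        rfl
      have hτpowCk : ∀ (n : ℕ) (b : F), b ∈ Cf k → (τ k ^ n) b ∈ Cf k := by
        intro n
        induction n with
        | zero => intro b hb; exact hb
        | succ n ih => intro b hb; rw [pow_succ', RingAut.mul_apply]; exact hτCk _ (ih b hb)
      have hτCk' : ∀ b ∈ Cf k, (τ k).symm b ∈ Cf k := fun b hb => by
        rw [hτsymm]; exact hτpowCk _ b hb
      let σ : Cf k ≃+* Cf k :=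
        { toFun := fun b => ⟨τ k b, hτCk b b.2⟩
          invFun := fun b => ⟨(τ k).symm b, hτCk' b b.2⟩
          left_inv := fun b => Subtype.ext ((τ k).symm_apply_apply b)
          right_inv := fun b => Subtype.ext ((τ k).apply_symm_apply b)
          map_mul' := fun a b => Subtype.ext (map_mul (τ k) (a : F) (b : F))
          map_add' := fun a b => Subtype.ext (map_add (τ k) (a : F) (b : F)) }
      have hσ_apply : ∀ b : Cf k, ((σ b : Cf k) : F) = τ k b := fun b => rfl
      have hσpow : ∀ (n : ℕ) (b : Cf k), (((σ ^ n) b : Cf k) : F) = (τ k ^ n) (b : F) := by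
        intro n
        induction n with
        | zero => intro b; rfl
        | succ n ih =>
          intro b; rw [pow_succ', RingAut.mul_apply, pow_succ', RingAut.mul_apply, hσ_apply, ih]
      have hσℓ : σ ^ ℓ = 1 := RingEquiv.ext fun b => Subtype.ext (by rw [hσpow, hτℓ k hk']; rfl)
      let ζC : Cf k := ⟨ζ, hζCk⟩
      have hσζ : σ ζC = ζC := Subtype.ext (hτζ k hk')
      have hζCℓ : ζC ^ ℓ = 1 := Subtype.ext (by
        change ((ζC ^ ℓ : Cf k) : F) = 1
        rw [SubmonoidClass.coe_pow]; exact hζℓ)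
      let AB : Subring (Cf k) := (Cf (k + 1)).comap (Cf k).subtype
      have hAB : ∀ b : Cf k, b ∈ AB ↔ σ b = b := fun b => by
        change (b : F) ∈ Cf (k + 1) ↔ _
        rw [hC', Subtype.ext_iff, hσ_apply]
        exact ⟨fun h => h.2, fun h => ⟨b.2, h⟩⟩
      haveI : IsNoetherianRing AB :=
        isNoetherianRing_fixedSubring_of_tameCyclic σ AB hAB hℓ0 hσℓ hℓuk ζC hσζ hζCℓ
      have hle : Cf (k + 1) ≤ Cf k := fun a ha => ((hC' a).mp ha).1
      let e : AB ≃+* Cf (k + 1) :=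
        { toFun := fun a => ⟨((a : Cf k) : F), a.2⟩
          invFun := fun a => ⟨⟨(a : F), hle a.2⟩, a.2⟩
          left_inv := fun a => rfl
          right_inv := fun a => rfl
          map_mul' := fun a b => rfl
          map_add' := fun a b => rfl }
      refine ⟨isNoetherianRing_of_ringEquiv AB e, ?_⟩
      rw [← hdimk]
      exact ringKrullDim_fixedSubring_eq (τ k) hℓ0 (hτℓ k hk') (Cf k) hτCk hℓuk ζ hζCk (hτζ k hk')
        hζℓ hζuk (Cf (k + 1)) hC'
  have hAeq : A = Cf r := Subring.ext fun b => by rw [hA, hmemCf]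
  subst hAeq
  exact (key r le_rfl).2

end Dimension

end Literature.AlgebraicGeometry.Resolution

end
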